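import Mathlib
import Summits.ValiantsHypothesis.ValiantsHypothesis.Theorems.DivisionGapPerMultiplesHardStubTransportation
import Summits.ValiantsHypothesis.ValiantsHypothesis.Theorems.DivisionGapPerMultiplesHardStubHeavyTable
import Summits.ValiantsHypothesis.ValiantsHypothesis.Theorems.DivisionGapPerMultiplesHardStubBlockSliceParts
import Summits.ValiantsHypothesis.ValiantsHypothesis.Theorems.DivisionGapPerMultiplesHardStubMarginSlice
import Summits.ValiantsHypothesis.ValiantsHypothesis.Theorems.DivisionGapPerMultiplesHardStubTwoBandTableW
import Summits.ValiantsHypothesis.ValiantsHypothesis.Theorems.DivisionGapPerMultiplesHardSpreadPatternsRelD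
import Summits.ValiantsHypothesis.ValiantsHypothesis.Theorems.DivisionGapPerMultiplesHardStubRelRegularCount
import Summits.ValiantsHypothesis.ValiantsHypothesis.Theorems.DivisionGapPerMultiplesHardStubFaceOntoHost
import Summits.ValiantsHypothesis.ValiantsHypothesis.Theorems.DivisionGapPerMultiplesHardStubBlockCompletion
import Summits.ValiantsHypothesis.ValiantsHypothesis.Theorems.DivisionGapPerMultiplesHardStubBlockMargins
import Summits.ValiantsHypothesis.ValiantsHypothesis.Theorems.DivisionGapPerMultiplesHardStubSmallWindowArith
import Summits.ValiantsHypothesis.ValiantsHypothesis.Theorems.DivisionGapPerMultiplesHardStubEventuallyExp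
import Summits.ValiantsHypothesis.ValiantsHypothesis.Theorems.DivisionGapPerMultiplesHardRelDenseCompleteClass
import Literature.Computability.AlgebraicComplexity.ArithCircuitProofs
import Literature.Computability.AlgebraicComplexity.PermanentIrreducible

/-!
# `DivisionGap.PerMultiplesHard` (stmt-ValiantsHypothesis-5068), line `uncharged-face-walk`:
a σ-SQUARE BLOCK WITH A REGULAR SHIFT-INTERSECTION MAKES THE COMPLETE CLASS ON A HOST HARD

For the crux `PerMultiplesHard` (the monotone exclusion complexity of the permanent: every nonzero
`h ∈ ℝ≥0[x_ij]` should make `per_n · h` need monotone circuits of size `> 2^{(log n + c)^c}`), the line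
`uncharged-face-walk` reduces complete-class cofactors — `t` torus-homogeneous with margins `(R, C)`
whose support contains EVERY table with these margins supported inside a host `G ⊆ [n]²` — to a
STRUCTURE statement about the host.  This file proves the reduction: if the host has a block
`A × B` of linear size (`n ≤ Cf · a`) carried by a block-diagonal matching `σ ⊆ G` (`σ(B) = A`), and
the transported block host `X = {(x, y) : (eA x, eB y) ∈ G}` meets its `finRotate`-shift (along the
enumeration `eA`) in a graph with an `f`-REGULAR spanning subgraph `Y'` of linear degree
(`a ≤ Cf · f`), then for balanced, `n`-close margins of offset `≥ 3n³`,
`2^{⌊n / (1024 Cf²)⌋} ≤ L⁺(per_G · t)` for all large `n` (`richHost_of_squareBlock`).  NO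
quasi-randomness of the block is asked.

Proof chain (every step a landed theorem of the line).
* `blockSlice_descent`: the face `1_G` (`FaceOntoHost.stub_faceOntoHost`) makes the support EXACTLY the
  class `T_G(R;C)`; a HEAVY table on the pattern of `σ` (`HeavyTable.stub_heavyTable` with
  `Transportation.stub_transportation`) has off-pattern mass `≤ n³`, so the maximal block-diagonal
  mass `μ` of a table of the class is `≥ ΣR − n³`; the `μ`-slice projected to the `a`-board
  (`BlockSliceParts.stub_blockSliceParts`) followed by one margin class (`MarginSlice.stub_marginSlice`)
  is a cofactor `q'` on the `a`-board whose support is a COMPLETE class `T_X(r'; c')` on the block host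
  (`BlockCompletion.stub_blockCompletion`), with deficits `r' + d = R ∘ eA`, `c' + e = C ∘ eB`,
  `Σ d + Σ e ≤ n³` (`BlockMargins.stub_blockMargins`), and `L(per_X · q') ≤ L(per_G · t) + 1`.
* `blockProbes`: every permutation inside `Y'` carries a `finRotate a`-spread probe in
  `supp (per_X · q')` (`TwoBandTableW.stub_twoBandTableW` with the ℓ¹ budget `a·n + n³`, then
  `RelDenseCompleteClass.probe_facePer_mul`).
* `smallWindowEngine`: the relative spread engine with the SMALL window `a < 1024·Cf·#S ≤ 2a`
  (`SpreadPatternsRelD.stub_spreadPatternsRelD`), the fibre count on the regular comparison host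
  `PM(Y')` — van der Waerden below, Brégman–Minc above with the TRIVIAL degree bounds `≤ #T`, `≤ f`
  (`RelRegularCount.stub_relRegularCount`) — and the arithmetic `SmallWindowArith.stub_smallWindowArith`
  give `16^k ≤ L² · e^{2(Cf+1)} · a^{Cf+1}` for some `k > a/(1024 Cf)`: Brégman's `(u!)^{1/u}` per column
  of `T` beats van der Waerden's `f/e` by `16` as soon as `u ≤ f/128`, so no mixing is needed.
* `richHost_of_squareBlock`: `EventuallyExp.stub_eventuallyExp` absorbs the polynomial factors.
Sources: Jerrum–Snir 1982 §3–4 (typed decompositions); Brégman 1973 (Minc's conjecture); Egorychev / Falikman 1981 (van der Waerden,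
tree `VanDerWaerdenPermanent_holds`).  The block-slice descent and the small-window jaw are this line's own devices (crux NOTES §I).
-/

noncomputable section

-- `Summit.ValiantsHypothesis.ValiantsHypothesis.…` is the tree's mandated layout (Sub = Summit).
set_option linter.dupNamespace false

namespace Summit.ValiantsHypothesis.ValiantsHypothesis.Theorems.DivisionGap.PerMultiplesHard.RichHostOfSquareBlock

open MvPolynomial Literature.Computability.AlgebraicComplexity
open scoped NNReal BigOperators
open Summit.ValiantsHypothesis.ValiantsHypothesis.Theorems.DivisionGap.PerMultiplesHard

/-- Torus-homogeneous polynomials are homogeneous: every exponent of `h` has degree `Σ r`. [folklore] -/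
theorem degree_eq_of_rows {n : ℕ} {h : MvPolynomial (Fin n × Fin n) ℝ≥0} {r : Fin n → ℕ}
    (hth : ∀ m ∈ h.support, ∀ i, ∑ j, m (i, j) = r i) :
    ∀ d ∈ h.support, d.degree = ∑ i, r i := by
  intro d hd
  have h1 : d.degree = ∑ e : Fin n × Fin n, d e := by
    unfold Finsupp.degree
    exact Finset.sum_subset (Finset.subset_univ _) (fun e _ he => Finsupp.notMem_support_iff.mp he)
  rw [h1, Fintype.sum_prod_type]
  exact Finset.sum_congr rfl (fun i _ => hth d hd i)

/-- **The block-slice descent (lead c7).**  Host `G`, `t` torus-homogeneous with margins `(R, C)` and COMPLETE on `G` with some `G`-table, margins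
balanced and `n`-close with `n² ≤ C_j`, and a block `A × B` (enumerations `eA, eB`) carried by a block-diagonal matching `σ ⊆ G`.  Then on the `a`-board,
with the transported block host `X = {(x,y) : (eA x, eB y) ∈ G}`, there are `q' ≠ 0`, margins `(r', c')` and deficits `(d, e)` with: every monomial of `q'`
has margins `(r', c')`; EVERY `X`-supported table with margins `(r', c')` is a monomial of `q'` (completeness on the block); `r' + d = R ∘ eA`,
`c' + e = C ∘ eB`, `Σ d + Σ e ≤ n³`, `Σ r' = Σ c'`; and `L(per_X · q') ≤ L(per_G · t) + 1`.  Composition of `FaceOntoHost.stub_faceOntoHost`, `HeavyTable.stub_heavyTable` ∘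
`Transportation.stub_transportation`, `BlockSliceParts.stub_blockSliceParts`, `MarginSlice.stub_marginSlice`, `BlockCompletion.stub_blockCompletion`, `BlockMargins.stub_blockMargins`. [folklore] -/
theorem blockSlice_descent {n : ℕ} (G : Finset (Fin n × Fin n)) (t : MvPolynomial (Fin n × Fin n) ℝ≥0) (R C : Fin n → ℕ)
    (ht : ∀ m ∈ t.support, (∀ i, ∑ j, m (i, j) = R i) ∧ (∀ j, ∑ i, m (i, j) = C j))
    (hcomp : ∀ M : (Fin n × Fin n) →₀ ℕ, M.support ⊆ G →
      (∀ i, ∑ j, M (i, j) = R i) → (∀ j, ∑ i, M (i, j) = C j) → M ∈ t.support)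
    (hex : ∃ M : (Fin n × Fin n) →₀ ℕ, M.support ⊆ G ∧ (∀ i, ∑ j, M (i, j) = R i) ∧ (∀ j, ∑ i, M (i, j) = C j))
    (hbal : ∑ i, R i = ∑ j, C j) (hclose : ∀ i j, R i ≤ C j + n ∧ C j ≤ R i + n) (hoffC : ∀ j, n * n ≤ C j)
    {a : ℕ} (A B : Finset (Fin n)) (eA : Fin a ≃ {x // x ∈ A}) (eB : Fin a ≃ {x // x ∈ B})
    (σ : Equiv.Perm (Fin n)) (hσG : ∀ i, (σ i, i) ∈ G) (hσAB : ∀ i, σ i ∈ A ↔ i ∈ B) :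
    ∃ (q' : MvPolynomial (Fin a × Fin a) ℝ≥0) (r' c' dd ee : Fin a → ℕ), q' ≠ 0 ∧
      (∀ m ∈ q'.support, (∀ x, ∑ y, m (x, y) = r' x) ∧ (∀ y, ∑ x, m (x, y) = c' y)) ∧
      (∀ m' : (Fin a × Fin a) →₀ ℕ,
        m'.support ⊆ Finset.univ.filter (fun e : Fin a × Fin a => ((eA e.1 : Fin n), (eB e.2 : Fin n)) ∈ G) →
        (∀ x, ∑ y, m' (x, y) = r' x) → (∀ y, ∑ x, m' (x, y) = c' y) → m' ∈ q'.support) ∧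
      (∀ x, r' x + dd x = R (eA x : Fin n)) ∧ (∀ y, c' y + ee y = C (eB y : Fin n)) ∧
      (∑ x, dd x) + (∑ y, ee y) ≤ n ^ 3 ∧ ∑ x, r' x = ∑ y, c' y ∧
      complexity ((∑ τ ∈ (Finset.univ : Finset (Equiv.Perm (Fin a))).filter
          (fun τ => ∀ i, (((eA (τ i) : Fin n), (eB i : Fin n)) ∈ G)), monomial (permMonomial τ) (1 : ℝ≥0)) * q') ≤
        complexity ((∑ σ ∈ (Finset.univ : Finset (Equiv.Perm (Fin n))).filter (fun σ => ∀ i, (σ i, i) ∈ G),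
          monomial (permMonomial σ) (1 : ℝ≥0)) * t) + 1 := by
  classical
  -- Step 1: the face onto the host
  obtain ⟨t₁, ht₁0, ht₁supp, ht₁c⟩ := FaceOntoHost.stub_faceOntoHost n G t R C ht hcomp hex
  have ht₁marg : ∀ m ∈ t₁.support, (∀ i, ∑ j, m (i, j) = R i) ∧ (∀ j, ∑ i, m (i, j) = C j) :=
    fun m hm => ((ht₁supp m).1 hm).2
  -- Step 2: a heavy table on the pattern of `σ`
  obtain ⟨Mh, hMhG, hMhR, hMhC, hMhheavy⟩ :=
    HeavyTable.stub_heavyTable Transportation.stub_transportation n n G σ R C hσG hex hclose hoffC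
  -- Step 3: the maximal block-diagonal mass `μ` on `T_G(R;C)`
  have ht₁ne : t₁.support.Nonempty := MvPolynomial.support_nonempty.mpr ht₁0
  obtain ⟨Mμ, hMμ, hmax⟩ := Finset.exists_max_image t₁.support
    (fun m : (Fin n × Fin n) →₀ ℕ => (m.filter (fun e : Fin n × Fin n => (e.1 ∈ A ↔ e.2 ∈ B))).degree) ht₁ne
  set μ : ℕ := (Mμ.filter (fun e : Fin n × Fin n => (e.1 ∈ A ↔ e.2 ∈ B))).degree with hμ
  -- the heavy table bounds `μ` from below: `ΣC ≤ μ + n³`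
  have hMh_t₁ : Mh ∈ t₁.support := (ht₁supp Mh).2 ⟨hMhG, hMhR, hMhC⟩
  have hμlow : ∑ j, C j ≤ μ + n ^ 3 := by
    have h1 : (Mh.filter (fun e : Fin n × Fin n => (e.1 ∈ A ↔ e.2 ∈ B))).degree ≤ μ := hmax Mh hMh_t₁
    have h2 : ∑ j, Mh (σ j, j) ≤ (Mh.filter (fun e : Fin n × Fin n => (e.1 ∈ A ↔ e.2 ∈ B))).degree := by
      have hdeg : (Mh.filter (fun e : Fin n × Fin n => (e.1 ∈ A ↔ e.2 ∈ B))).degree =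
          ∑ e : Fin n × Fin n, (Mh.filter (fun e : Fin n × Fin n => (e.1 ∈ A ↔ e.2 ∈ B))) e := by
        unfold Finsupp.degree
        exact Finset.sum_subset (Finset.subset_univ _) (fun e _ he => Finsupp.notMem_support_iff.mp he)
      rw [hdeg]
      have hinj : Function.Injective (fun j : Fin n => (σ j, j)) := fun j j' h => (Prod.ext_iff.mp h).2
      calc ∑ j, Mh (σ j, j)
          = ∑ j, (Mh.filter (fun e : Fin n × Fin n => (e.1 ∈ A ↔ e.2 ∈ B))) (σ j, j) := by
            refine Finset.sum_congr rfl fun j _ => ?_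
            rw [Finsupp.filter_apply, if_pos (hσAB j)]
        _ = ∑ e ∈ Finset.univ.image (fun j : Fin n => (σ j, j)),
              (Mh.filter (fun e : Fin n × Fin n => (e.1 ∈ A ↔ e.2 ∈ B))) e := by
            rw [Finset.sum_image (fun j _ j' _ h => hinj h)]
        _ ≤ _ := Finset.sum_le_sum_of_subset_of_nonneg (Finset.subset_univ _) (fun _ _ _ => Nat.zero_le _)
    have h3 : ∑ j, C j ≤ ∑ j, (Mh (σ j, j) + n * n) := Finset.sum_le_sum fun j _ => hMhheavy j
    rw [Finset.sum_add_distrib, Finset.sum_const, Finset.card_univ, Fintype.card_fin, smul_eq_mul] at h3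
    have h4 : n * (n * n) = n ^ 3 := by ring
    omega
  -- Step 4: the block slice along `μ`, projected to the `a`-board
  obtain ⟨q, hq0, hqsupp, hqc⟩ := BlockSliceParts.stub_blockSliceParts n G t₁ ht₁0 (∑ i, R i)
    (degree_eq_of_rows (fun m hm => (ht₁marg m hm).1)) A B a eA eB μ ⟨Mμ, hMμ, rfl⟩ hmax ⟨σ, hσG, hσAB⟩
  -- the block host on the `a`-board
  set X : Finset (Fin a × Fin a) :=
    Finset.univ.filter (fun e : Fin a × Fin a => ((eA e.1 : Fin n), (eB e.2 : Fin n)) ∈ G) with hX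
  have hmemX : ∀ e : Fin a × Fin a, e ∈ X ↔ ((eA e.1 : Fin n), (eB e.2 : Fin n)) ∈ G := by
    intro e; simp [hX]
  have hfilt : (Finset.univ : Finset (Equiv.Perm (Fin a))).filter
        (fun τ => ∀ i, (((eA (τ i) : Fin n), (eB i : Fin n)) ∈ G)) =
      (Finset.univ : Finset (Equiv.Perm (Fin a))).filter (fun τ => ∀ i, (τ i, i) ∈ X) := by
    refine Finset.filter_congr fun τ _ => ?_
    simp only [hmemX]
  have hperX : (∑ τ ∈ (Finset.univ : Finset (Equiv.Perm (Fin a))).filter (fun τ => ∀ i, (τ i, i) ∈ X),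
          monomial (permMonomial τ) (1 : ℝ≥0)) =
      (∑ τ ∈ (Finset.univ : Finset (Equiv.Perm (Fin a))).filter
          (fun τ => ∀ i, (((eA (τ i) : Fin n), (eB i : Fin n)) ∈ G)), monomial (permMonomial τ) (1 : ℝ≥0)) := by
    rw [hfilt]
  -- Step 5: one margin class
  obtain ⟨q', r', c', hq'0, hq'supp, hq'c⟩ := MarginSlice.stub_marginSlice a X q hq0
  rw [hperX] at hq'c
  have hq'marg : ∀ m ∈ q'.support, (∀ x, ∑ y, m (x, y) = r' x) ∧ (∀ y, ∑ x, m (x, y) = c' y) :=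
    fun m hm => ((hq'supp m).1 hm).2
  -- a witness monomial of `q'` and its lift `M₀ ∈ T_G(R;C)` of block-diagonal mass `μ`
  obtain ⟨m₀, hm₀⟩ := MvPolynomial.support_nonempty.mpr hq'0
  obtain ⟨hm₀q, hm₀r, hm₀c⟩ := (hq'supp m₀).1 hm₀
  obtain ⟨M₀, hM₀t₁, hM₀μ, hM₀res⟩ := (hqsupp m₀).1 hm₀q
  obtain ⟨hM₀G, hM₀R, hM₀C⟩ := (ht₁supp M₀).1 hM₀t₁
  have hr'blk : ∀ x : Fin a, r' x = ∑ y, M₀ ((eA x : Fin n), (eB y : Fin n)) := by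
    intro x; rw [← hm₀r x]; exact Finset.sum_congr rfl fun y _ => hM₀res x y
  have hc'blk : ∀ y : Fin a, c' y = ∑ x, M₀ ((eA x : Fin n), (eB y : Fin n)) := by
    intro y; rw [← hm₀c y]; exact Finset.sum_congr rfl fun x _ => hM₀res x y
  -- Step 6: the class `(r', c')` is COMPLETE on `X`
  have hcompX : ∀ m' : (Fin a × Fin a) →₀ ℕ, m'.support ⊆ X →
      (∀ x, ∑ y, m' (x, y) = r' x) → (∀ y, ∑ x, m' (x, y) = c' y) → m' ∈ q'.support := by
    intro m' hm'X hm'r hm'c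
    have hm'G : ∀ e ∈ m'.support, ((eA e.1 : Fin n), (eB e.2 : Fin n)) ∈ G :=
      fun e he => (hmemX e).1 (hm'X he)
    obtain ⟨M, hMG, hMR, hMC, hMμ, hMres⟩ := BlockCompletion.stub_blockCompletion n a G A B eA eB M₀ m' hM₀G hm'G
      (fun x => by rw [hm'r x, hr'blk x]) (fun y => by rw [hm'c y, hc'blk y])
    have hMt₁ : M ∈ t₁.support :=
      (ht₁supp M).2 ⟨hMG, fun i => by rw [hMR i, hM₀R i], fun j => by rw [hMC j, hM₀C j]⟩
    have hm'q : m' ∈ q.support :=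
      (hqsupp m').2 ⟨M, hMt₁, by rw [hMμ, hM₀μ], fun x y => (hMres x y).symm⟩
    exact (hq'supp m').2 ⟨hm'q, hm'r, hm'c⟩
  -- Step 7: deficits
  obtain ⟨dd, ee, hdd, hee, hsum⟩ := BlockMargins.stub_blockMargins n a A B eA eB M₀ R C r' c' hM₀R hM₀C hr'blk hc'blk
  have hde : (∑ x, dd x) + (∑ y, ee y) ≤ n ^ 3 := by
    rw [hM₀μ] at hsum
    have := hμlow
    rw [← hbal] at this
    omega
  have hbal' : ∑ x, r' x = ∑ y, c' y := by
    calc ∑ x, r' x = ∑ x, ∑ y, m₀ (x, y) := Finset.sum_congr rfl fun x _ => (hm₀r x).symm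
      _ = ∑ y, ∑ x, m₀ (x, y) := Finset.sum_comm
      _ = ∑ y, c' y := Finset.sum_congr rfl fun y _ => hm₀c y
  refine ⟨q', r', c', dd, ee, hq'0, hq'marg, hcompX, hdd, hee, hde, hbal', ?_⟩
  calc complexity ((∑ τ ∈ (Finset.univ : Finset (Equiv.Perm (Fin a))).filter
          (fun τ => ∀ i, (((eA (τ i) : Fin n), (eB i : Fin n)) ∈ G)), monomial (permMonomial τ) (1 : ℝ≥0)) * q')
      ≤ complexity ((∑ τ ∈ (Finset.univ : Finset (Equiv.Perm (Fin a))).filter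
          (fun τ => ∀ i, (((eA (τ i) : Fin n), (eB i : Fin n)) ∈ G)), monomial (permMonomial τ) (1 : ℝ≥0)) * q) := hq'c
    _ ≤ complexity ((∑ σ ∈ (Finset.univ : Finset (Equiv.Perm (Fin n))).filter (fun σ => ∀ i, (σ i, i) ∈ G),
          monomial (permMonomial σ) (1 : ℝ≥0)) * t₁) + 1 := hqc
    _ ≤ complexity ((∑ σ ∈ (Finset.univ : Finset (Equiv.Perm (Fin n))).filter (fun σ => ∀ i, (σ i, i) ∈ G),
          monomial (permMonomial σ) (1 : ℝ≥0)) * t) + 1 := Nat.add_le_add_right ht₁c 1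

/-- **Offset arithmetic for the block probes (lead c7).** [folklore] -/
theorem blockProbe_offset {n a q cy ey S : ℕ} (hn : 2 ≤ n) (han : a ≤ n) (hq : 3 * n ^ 3 ≤ q) (hcy : q ≤ cy + ey + n)
    (hey : ey ≤ S) (hS : S ≤ n ^ 3) : a * n + n ^ 3 ≤ cy := by
  have h1 : a * n ≤ n * n := Nat.mul_le_mul_right n han
  have h2 : n * n + n ≤ n ^ 3 := by
    have h3 : n * n * 2 ≤ n * n * n := Nat.mul_le_mul_left _ hn
    have h4 : n ≤ n * n := Nat.le_mul_of_pos_left n (by omega)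
    calc n * n + n ≤ n * n + n * n := by omega
      _ = n * n * 2 := by ring
      _ ≤ n * n * n := h3
      _ = n ^ 3 := by ring
  omega

/-- **Every matching inside `Y'` is probed (lead c7).**  On the `a`-board: `q'` with margins `(r', c')` COMPLETE on the host `X`, deficits `(d, e)` against
`n`-close margins `(R ∘ eA, C ∘ eB)` of offset `≥ 3n³` with `Σ d + Σ e ≤ n³`, and `Y'` inside `X` together with its `finRotate`-shift: then every
permutation inside `Y'` has a `finRotate a`-spread probe in `supp (per_X · q')` (`TwoBandTableW.stub_twoBandTableW` with the budget `W = a·n + n³`, then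
`RelDenseCompleteClass.probe_facePer_mul`). [folklore] -/
theorem blockProbes {n a : ℕ} (hn : 2 ≤ n) (han : a ≤ n) (G : Finset (Fin n × Fin n)) (R C : Fin n → ℕ)
    (hclose : ∀ i j, R i ≤ C j + n ∧ C j ≤ R i + n) (hoff : ∀ i, 3 * n ^ 3 ≤ R i)
    (A B : Finset (Fin n)) (eA : Fin a ≃ {x // x ∈ A}) (eB : Fin a ≃ {x // x ∈ B})
    (Y' : Finset (Fin a × Fin a))
    (hY' : ∀ e ∈ Y', ((eA e.1 : Fin n), (eB e.2 : Fin n)) ∈ G ∧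
      ((eA ((finRotate a).symm e.1) : Fin n), (eB e.2 : Fin n)) ∈ G)
    (q' : MvPolynomial (Fin a × Fin a) ℝ≥0) (r' c' dd ee : Fin a → ℕ)
    (hcompX : ∀ m' : (Fin a × Fin a) →₀ ℕ,
      m'.support ⊆ Finset.univ.filter (fun e : Fin a × Fin a => ((eA e.1 : Fin n), (eB e.2 : Fin n)) ∈ G) →
      (∀ x, ∑ y, m' (x, y) = r' x) → (∀ y, ∑ x, m' (x, y) = c' y) → m' ∈ q'.support)
    (hdd : ∀ x, r' x + dd x = R (eA x : Fin n)) (hee : ∀ y, c' y + ee y = C (eB y : Fin n))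
    (hde : (∑ x, dd x) + (∑ y, ee y) ≤ n ^ 3) (hbal' : ∑ x, r' x = ∑ y, c' y) :
    ∀ π : Equiv.Perm (Fin a), (∀ y, (π y, y) ∈ Y') →
      ∃ m ∈ ((∑ τ ∈ (Finset.univ : Finset (Equiv.Perm (Fin a))).filter
          (fun τ => ∀ i, (((eA (τ i) : Fin n), (eB i : Fin n)) ∈ G)), monomial (permMonomial τ) (1 : ℝ≥0)) * q').support,
        ∀ e ∈ m.support, π e.2 = e.1 ∨ π e.2 = finRotate a e.1 := by
  classical
  set X : Finset (Fin a × Fin a) :=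
    Finset.univ.filter (fun e : Fin a × Fin a => ((eA e.1 : Fin n), (eB e.2 : Fin n)) ∈ G) with hX
  have hmemX : ∀ e : Fin a × Fin a, e ∈ X ↔ ((eA e.1 : Fin n), (eB e.2 : Fin n)) ∈ G := by intro e; simp [hX]
  intro π hπ
  have hdisc : ∀ y, r' (π y) ≤ c' y + (n + dd (π y) + ee y) ∧ c' y ≤ r' (π y) + (n + dd (π y) + ee y) := by
    intro y
    have h1 := hdd (π y)
    have h2 := hee y
    have h3 := hclose (eA (π y) : Fin n) (eB y : Fin n)
    omega
  have hW : ∑ y, (n + dd (π y) + ee y) ≤ a * n + n ^ 3 := by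
    have h1 : ∑ y, dd (π y) = ∑ x, dd x := Equiv.sum_comp π dd
    rw [Finset.sum_add_distrib, Finset.sum_add_distrib, Finset.sum_const, Finset.card_univ, Fintype.card_fin,
      smul_eq_mul, h1]
    omega
  have hoffc : ∀ y, a * n + n ^ 3 ≤ c' y := by
    intro y
    have h4 : ee y ≤ ∑ y, ee y := Finset.single_le_sum (fun _ _ => Nat.zero_le _) (Finset.mem_univ y)
    exact blockProbe_offset hn han (hoff (eB y : Fin n))
      (by have := (hclose (eB y : Fin n) (eB y : Fin n)).1; have := hee y; omega) h4
      (le_trans (Nat.le_add_left _ _) hde)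
  obtain ⟨Mπ, hMπband, hMπr, hMπc⟩ := TwoBandTableW.stub_twoBandTableW a (a * n + n ^ 3) π r' c'
    (fun y => n + dd (π y) + ee y) hbal' hdisc hW hoffc
  -- it lies inside `X`, hence in `supp q'`
  have hMπX : Mπ.support ⊆ X := by
    intro e he
    rw [hmemX]
    rcases hMπband e he with h | h
    · have := (hY' (π e.2, e.2) (hπ e.2)).1
      rw [h] at this; exact this
    · have := (hY' (π e.2, e.2) (hπ e.2)).2
      have he1 : (finRotate a).symm (π e.2) = e.1 := by rw [h]; exact Equiv.symm_apply_apply _ _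
      rw [he1] at this; exact this
  have hMπq' : Mπ ∈ q'.support := hcompX Mπ hMπX hMπr hMπc
  have hπX : ∀ i, (π i, i) ∈ X := fun i => (hmemX _).2 (hY' (π i, i) (hπ i)).1
  have hfilt : (Finset.univ : Finset (Equiv.Perm (Fin a))).filter
        (fun τ => ∀ i, (((eA (τ i) : Fin n), (eB i : Fin n)) ∈ G)) =
      (Finset.univ : Finset (Equiv.Perm (Fin a))).filter (fun τ => ∀ i, (τ i, i) ∈ X) := by
    refine Finset.filter_congr fun τ _ => ?_
    simp only [hmemX]
  rw [hfilt]
  exact RelDenseCompleteClass.probe_facePer_mul X π hπX hMπq' hMπband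

/-- **The small-window engine on a regular comparison host (lead c7).**  On the `a`-board: `g` torus-homogeneous with nonzero rows, `Y'` `f`-regular
(`f ≥ 1`, `a ≤ Cf·f`, `1024·Cf ≤ a`) all of whose matchings are `finRotate a`-probed in `supp g`: then `16^k ≤ L(g)² · e^{2(Cf+1)} · a^{Cf+1}` for some
window `a < 1024·Cf·k` (`SpreadPatternsRelD.stub_spreadPatternsRelD` + `RelRegularCount.stub_relRegularCount` + `SmallWindowArith.stub_smallWindowArith`). [folklore] -/
theorem smallWindowEngine {a Cf f : ℕ} (ha1 : 1 ≤ a) (hDa : 1024 * Cf ≤ a) (hCf : 1 ≤ Cf)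
    (g : MvPolynomial (Fin a × Fin a) ℝ≥0) (ρ γ : Fin a → ℕ)
    (hg : ∀ m ∈ g.support, (∀ i, ∑ j, m (i, j) = ρ i) ∧ (∀ j, ∑ i, m (i, j) = γ j)) (hρ : ∀ i, ρ i ≠ 0)
    (Y' : Finset (Fin a × Fin a)) (hf1 : 1 ≤ f) (haf : a ≤ Cf * f)
    (hYrow : ∀ x : Fin a, (Finset.univ.filter fun y : Fin a => (x, y) ∈ Y').card = f)
    (hYcol : ∀ y : Fin a, (Finset.univ.filter fun x : Fin a => (x, y) ∈ Y').card = f)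
    (hprobed : ∀ π : Equiv.Perm (Fin a), (∀ y, (π y, y) ∈ Y') →
      ∃ m ∈ g.support, ∀ e ∈ m.support, π e.2 = e.1 ∨ π e.2 = finRotate a e.1) :
    ∃ k : ℕ, a < 1024 * Cf * k ∧
      (16 : ℝ) ^ k ≤ ((complexity g : ℕ) : ℝ) ^ 2 * Real.exp (2 * ((Cf : ℝ) + 1)) * (a : ℝ) ^ (Cf + 1) := by
  classical
  obtain ⟨S, T, hwin1, hwin2, hcap⟩ := SpreadPatternsRelD.stub_spreadPatternsRelD a (1024 * Cf) (by omega) hDa (finRotate a) g ρ γ hg hρ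
    ((Finset.univ : Finset (Equiv.Perm (Fin a))).filter fun π => ∀ y, (π y, y) ∈ Y')
  have hall : ((Finset.univ : Finset (Equiv.Perm (Fin a))).filter (fun π => ∀ y, (π y, y) ∈ Y')).filter
      (fun π => ∃ m ∈ g.support, ∀ e ∈ m.support, π e.2 = e.1 ∨ π e.2 = finRotate a e.1) =
      (Finset.univ : Finset (Equiv.Perm (Fin a))).filter (fun π => ∀ y, (π y, y) ∈ Y') := by
    refine Finset.filter_true_of_mem fun π hπ => ?_
    exact hprobed π (Finset.mem_filter.mp hπ).2
  rw [hall] at hcap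
  obtain ⟨hST1, hST2, hineq⟩ := RelRegularCount.stub_relRegularCount a Y' f hf1 hYrow hYcol (finRotate a) S T (complexity g) hcap
  have hfa : f ≤ a := by
    have := hYrow ⟨0, ha1⟩
    rw [← this]
    exact (Finset.card_filter_le _ _).trans (by simp)
  have hua : T.card ≤ a := (Finset.card_le_univ T).trans (by simp)
  exact ⟨S.card, hwin1, SmallWindowArith.stub_smallWindowArith a f S.card T.card (complexity g) Cf (1024 * Cf) ha1 hf1 hfa haf rfl
    hwin1 hwin2 hST1 hST2 hua hineq⟩

/-- **A σ-square block with a regular shift-intersection makes the complete class hard (lead c7, cycle 7 of the line).**  For every `Cf ≥ 1`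
there is `n₀` such that for `n ≥ n₀`: if `t` is torus-homogeneous with margins `(R, C)`, COMPLETE on the host `G ⊆ [n]²` (every `G`-supported
table with margins `(R;C)` is an exponent), some such table exists, the margins are balanced, `n`-close and of offset `≥ 3n³`, AND the host
has a block `A × B` enumerated by `eA, eB : Fin a ≃ A, B` of linear size (`n ≤ Cf·a`) carried by a block-diagonal perfect matching `σ ⊆ G`
(`σ i ∈ A ↔ i ∈ B`) whose transported block host meets its `finRotate`-shift in a graph with an `f`-REGULAR spanning subgraph `Y'`,
`1 ≤ f`, `a ≤ Cf·f` — then `2^{⌊n/(1024·Cf²)⌋} ≤ L⁺(per_G · t)`.  Composition of `blockSlice_descent`, `blockProbes`, `smallWindowEngine` and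
`EventuallyExp.stub_eventuallyExp`. [folklore] -/
theorem richHost_of_squareBlock :
    ∀ Cf : ℕ, 1 ≤ Cf → ∃ n₀ : ℕ, ∀ n ≥ n₀, ∀ (G : Finset (Fin n × Fin n))
      (t : MvPolynomial (Fin n × Fin n) ℝ≥0) (R C : Fin n → ℕ),
      (∀ m ∈ t.support, (∀ i, ∑ j, m (i, j) = R i) ∧ (∀ j, ∑ i, m (i, j) = C j)) →
      (∀ M : (Fin n × Fin n) →₀ ℕ, M.support ⊆ G →
        (∀ i, ∑ j, M (i, j) = R i) → (∀ j, ∑ i, M (i, j) = C j) → M ∈ t.support) →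
      (∃ M : (Fin n × Fin n) →₀ ℕ, M.support ⊆ G ∧ (∀ i, ∑ j, M (i, j) = R i) ∧ (∀ j, ∑ i, M (i, j) = C j)) →
      ∑ i, R i = ∑ j, C j →
      (∀ i j, R i ≤ C j + n ∧ C j ≤ R i + n) →
      (∀ i, 3 * n ^ 3 ≤ R i) →
      ∀ (a : ℕ) (A B : Finset (Fin n)) (eA : Fin a ≃ {x // x ∈ A}) (eB : Fin a ≃ {x // x ∈ B})
        (σ : Equiv.Perm (Fin n)) (Y' : Finset (Fin a × Fin a)) (f : ℕ),
        n ≤ Cf * a → (∀ i, (σ i, i) ∈ G) → (∀ i, σ i ∈ A ↔ i ∈ B) → 1 ≤ f → a ≤ Cf * f →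
        (∀ e ∈ Y', ((eA e.1 : Fin n), (eB e.2 : Fin n)) ∈ G ∧
          ((eA ((finRotate a).symm e.1) : Fin n), (eB e.2 : Fin n)) ∈ G) →
        (∀ x : Fin a, (Finset.univ.filter fun y : Fin a => (x, y) ∈ Y').card = f) →
        (∀ y : Fin a, (Finset.univ.filter fun x : Fin a => (x, y) ∈ Y').card = f) →
        2 ^ (n / (Cf * (1024 * Cf))) ≤
          complexity ((∑ σ ∈ (Finset.univ : Finset (Equiv.Perm (Fin n))).filter (fun σ => ∀ i, (σ i, i) ∈ G),
            monomial (permMonomial σ) (1 : ℝ≥0)) * t) := by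
  classical
  intro Cf hCf
  obtain ⟨n₂, hev⟩ := EventuallyExp.stub_eventuallyExp Cf (1024 * Cf) hCf (by omega)
  refine ⟨n₂ + 1024 * Cf * Cf + 2, ?_⟩
  intro n hn G t R C ht hcomp hex hbal hclose hoff a A B eA eB σ Y' f hna hσG hσAB hf1 haf hY' hYrow hYcol
  have hn₂ : n₂ ≤ n := by omega
  have hn2 : 2 ≤ n := by omega
  -- sizes
  have haA : a = A.card := by simpa using Fintype.card_congr eA
  have han : a ≤ n := by rw [haA]; exact (Finset.card_le_univ A).trans (by simp)
  have ha1 : 1 ≤ a := by rcases Nat.eq_zero_or_pos a with h0 | h0 <;> [(subst h0; omega); exact h0]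
  have hDa : 1024 * Cf ≤ a := by have h1 : 1024 * Cf * Cf ≤ n := (by omega); nlinarith
  have hoffC : ∀ j, n * n ≤ C j := by
    intro j
    have h1 := (hclose (σ j) j).1; have h2 := hoff (σ j)
    have h3 : n * n ≤ n ^ 3 := by rw [pow_succ, sq]; exact Nat.le_mul_of_pos_right _ (by omega)
    have h4 : n ≤ n ^ 3 := le_trans (Nat.le_mul_of_pos_left n (by omega)) h3
    omega
  -- the block-slice descent
  obtain ⟨q', r', c', dd, ee, hq'0, hq'marg, hcompX, hdd, hee, hde, hbal', hcx⟩ :=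
    blockSlice_descent G t R C ht hcomp hex hbal hclose hoffC A B eA eB σ hσG hσAB
  -- probes
  have hprobed := blockProbes hn2 han G R C hclose hoff A B eA eB Y' hY' q' r' c' dd ee hcompX hdd hee hde hbal'
  -- margins of `per_X · q'` (the block host in the `X`-form)
  set X : Finset (Fin a × Fin a) :=
    Finset.univ.filter (fun e : Fin a × Fin a => ((eA e.1 : Fin n), (eB e.2 : Fin n)) ∈ G) with hX
  have hmemX : ∀ e : Fin a × Fin a, e ∈ X ↔ ((eA e.1 : Fin n), (eB e.2 : Fin n)) ∈ G := by
    intro e; simp [hX]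
  have hfilt : (Finset.univ : Finset (Equiv.Perm (Fin a))).filter
        (fun τ => ∀ i, (((eA (τ i) : Fin n), (eB i : Fin n)) ∈ G)) =
      (Finset.univ : Finset (Equiv.Perm (Fin a))).filter (fun τ => ∀ i, (τ i, i) ∈ X) := by
    refine Finset.filter_congr fun τ _ => ?_
    simp only [hmemX]
  have hgmarg := RelDenseCompleteClass.margins_facePer_mul X hq'marg
  rw [← hfilt] at hgmarg
  have hr'0 : ∀ x, r' x + 1 ≠ 0 := fun x => Nat.succ_ne_zero _
  obtain ⟨k, hk, h16⟩ := smallWindowEngine ha1 hDa hCf _ (fun x => r' x + 1) (fun y => c' y + 1)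
    hgmarg hr'0 Y' hf1 haf hYrow hYcol hprobed
  -- the complexity chain and the final absorption
  set L₀ : ℕ := complexity ((∑ σ ∈ (Finset.univ : Finset (Equiv.Perm (Fin n))).filter (fun σ => ∀ i, (σ i, i) ∈ G),
      monomial (permMonomial σ) (1 : ℝ≥0)) * t) with hL₀
  set L₁ : ℕ := complexity ((∑ τ ∈ (Finset.univ : Finset (Equiv.Perm (Fin a))).filter
      (fun τ => ∀ i, (((eA (τ i) : Fin n), (eB i : Fin n)) ∈ G)), monomial (permMonomial τ) (1 : ℝ≥0)) * q') with hL₁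
  have hmono : ((L₁ : ℕ) : ℝ) ^ 2 ≤ ((L₀ : ℝ) + 1) ^ 2 := by
    have : ((L₁ : ℕ) : ℝ) ≤ (L₀ : ℝ) + 1 := by exact_mod_cast hcx
    exact pow_le_pow_left₀ (Nat.cast_nonneg _) this 2
  have hfinal : (16 : ℝ) ^ k ≤ ((L₀ : ℝ) + 1) ^ 2 * Real.exp (2 * ((Cf : ℝ) + 1)) * (a : ℝ) ^ (Cf + 1) := by
    refine h16.trans ?_
    have hpos : 0 ≤ Real.exp (2 * ((Cf : ℝ) + 1)) * (a : ℝ) ^ (Cf + 1) := by positivity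
    calc ((L₁ : ℕ) : ℝ) ^ 2 * Real.exp (2 * ((Cf : ℝ) + 1)) * (a : ℝ) ^ (Cf + 1)
        = ((L₁ : ℕ) : ℝ) ^ 2 * (Real.exp (2 * ((Cf : ℝ) + 1)) * (a : ℝ) ^ (Cf + 1)) := by ring
      _ ≤ ((L₀ : ℝ) + 1) ^ 2 * (Real.exp (2 * ((Cf : ℝ) + 1)) * (a : ℝ) ^ (Cf + 1)) :=
          mul_le_mul_of_nonneg_right hmono hpos
      _ = _ := by ring
  exact hev n hn₂ a k L₀ hna han hk hfinal

end Summit.ValiantsHypothesis.ValiantsHypothesis.Theorems.DivisionGap.PerMultiplesHard.RichHostOfSquareBlock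

end
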